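import Summits.MatrixMultiplication.MatrixMultiplication.Theorems.ObstructionDescentUnitOrbitPrime
import Summits.MatrixMultiplication.MatrixMultiplication.Theorems.ObstructionCalculusLocality

set_option linter.dupNamespace false

/-!
# The invariant tower of `ObstructionDescent` is a statement about LEVELS (decomp-mm · lens 3 · gen 10–11)

Route `route-MatrixMultiplication-ObstructionDescent` (sub-problem `MatrixMultiplication`, `ω(ℂ) = 2`), rev 6 `ab442fba73aa`;
support for the aside **`InvariantSaturation`** (item `stmt-MatrixMultiplication-32282`, the invariant tower).  Imports the LANDED
calculus (`ObstructionCalculusAction/Invariants/Locality`) and the landed semigroup engine (`ObstructionDescentUnitOrbitPrime`: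
`mul_mem_hwvSpace`, `mul_mem_orbitVanishing_unitTensor_iff`, `not_hwvSpace_add_le_orbitVanishing_unitTensor`); restates nothing.

A LEVEL `k` at a cell `(n, m)` (`N = n²`) is the space `W_k = hwvSpace (rectType m N k) (k·N)` of weight vectors of the rectangular
type `((k^N))³` carried by the LAST `N` coordinates of each slot — the pulled-back `SL_N³`-invariants of degree `kN`.  Three
semigroups of levels:
* `passLevels m N` — levels whose weight vectors do not all vanish on `GL_m³·⟨m⟩` (closed under `+` because `I(GL_m³·⟨m⟩)` is
  prime: `add_mem_passLevels`; level `0` and every non-empty level of degree `kN ≤ m` pass: R1, `mem_passLevels_of_degree_le`);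
* `pointLevels N t` — levels having a weight vector NON-ZERO AT A POINT `t` (a monoid because `(fg)(t) = f(t)g(t)`); for a
  polystable `w` of format `N` padded into `m` this is the exponent monoid `E'(w)` of Bürgisser–Ikenmeyer (2017, (5.2), Thm 5.3);
* the point `⟨N⟩` right-aligned (`padUnitLast m N = [P|P|P]`, rank `≤ m` for free) has `pointLevels ⊆ passLevels`.
**H6 (cell theorem `tower_of_levels`).**  The tower at `(n, m)` — every level of degree `> m` passes or is empty,
`{k | m < k n²} ⊆ passLevels ∪ emptyLevels` — follows from four LEVEL HYPOTHESES, all stated inline (no proposition is defined in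
this file): (K0) levels `0 < k < n` are empty (BI17 Thm 5.9(1)); (U) every even level `≥ n` is a level of the point `⟨n²⟩` (`e = n`:
BI17 Problem 5.23, the Latin-cube question; a FINITE check per `n`: `unitLevels_of_prim`); (Ko) an odd level `≤ n+1` is non-empty
(BI17 Thm 5.9(3) for odd `n`; Amanov–Yeliussizov 2022 Thm 5.1(ii) for `n+1`); (P) the non-empty ODD levels `k ∈ [n, 2n)` of degree
`> m` pass — (P) is vacuous once `2n·n² ≤ m`, so for `3 < τ < 4` the tower needs no information about `σ_m` at all
(`invariantSaturation_three_of_unitLevels`).  The tree item is identified with its level reading in `invariantSaturation_iff_levels`.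
All statements over `ℂ`; no `sorry`; standard axioms.
Source: gen-10/11 kernel `ExponentMonoids_g11_tree.lean` Parts 8.5, 11, 12 (bodies byte-identical up to the landed API).
[cite: BurgisserIkenmeyer2017, §5 (5.2), Thm 5.3, Thm 5.9, Problem 5.23; BurgisserIkenmeyer2011, Lemma 3.2]
-/

noncomputable section

open scoped BigOperators
open Finset Filter

namespace Summit.MatrixMultiplication.MatrixMultiplication.Theorems.ObstructionCalculus

open Literature.Computability.AlgebraicComplexity (tensorRank matMulTensor unitTensor actTensor)

section InvariantTower

variable {m : ℕ}

/-! ### 1 · Rectangular levels, R1 in occurrence form, the padded unit point -/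

/-- The rectangular type `((k^N))³` on the LAST `N` coordinates of each slot (indices `i ≥ m − N`), zeros before: for `N = n²`
these are the types of the `SL_{n²}³`-invariants of degree `k n²` pulled back along the coordinate projections onto the last `n²`
coordinates.  (Right alignment is the live one: in this calculus non-zero weight vectors have non-decreasing exponents along each
slot.) [cite: BurgisserIkenmeyer2017, §5 (degree monoid `E(n²)`)] -/
def rectType (m N k : ℕ) : Fin 3 → Fin m → ℕ := fun _ i => if m ≤ (i : ℕ) + N then k else 0

/-- Rectangular types add level-wise. [bookkeeping] -/
theorem rectType_add (N e o : ℕ) : rectType m N e + rectType m N o = rectType m N (e + o) := by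
  funext s i
  simp only [Pi.add_apply, rectType]
  split_ifs <;> simp

/-- R1 read as an occurrence statement: a NON-ZERO type of degree `d ≤ m` occurs in `ℂ[σ_m]`. [this node] -/
theorem not_le_orbitVanishing_unitTensor_of_degree_le {Λ : Fin 3 → Fin m → ℕ} {d : ℕ} (hd : d ≤ m)
    (hne : hwvSpace Λ d ≠ ⊥) : ¬ hwvSpace Λ d ≤ orbitVanishing (unitTensor ℂ m) :=
  fun h => hne (hwvSpace_eq_bot_of_degree_le hd h)

variable (m) in
/-- The diagonal `0/1` matrix projecting onto the last `N` coordinates. [bookkeeping] -/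
def lastProj (N : ℕ) : Matrix (Fin m) (Fin m) ℂ :=
  Matrix.diagonal fun i => if m ≤ (i : ℕ) + N then 1 else 0

variable (m) in
/-- The unit tensor `⟨N⟩` on the last `N` coordinates, zero-padded to `m`, written as `[P|P|P]`, `P = lastProj m N` (a point of
`Mat_m³·⟨m⟩`). [bookkeeping] -/
def padUnitLast (N : ℕ) : Tensor ℂ m := fromCols (lastProj m N) (lastProj m N) (lastProj m N)

/-- A polynomial vanishing on the orbit `GL_m³·⟨m⟩` vanishes at every `[A|B|C]` (density, landed calculus). [this node] -/
theorem evalT_fromCols_eq_zero_of_mem_orbitVanishing {f : MvPolynomial (Idx m) ℂ}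
    (hf : f ∈ orbitVanishing (unitTensor ℂ m)) (A B C : Matrix (Fin m) (Fin m) ℂ) :
    evalT (fromCols A B C) f = 0 :=
  evalT_fromCols_eq_zero_of_generic f (fun A B C hA hB hC => by
    have h := hf A B C hA hB hC
    rwa [actTensor_unitTensor] at h) A B C

/-! ### 2 · Passing levels and the levels of a point -/

variable (m) in
/-- The PASSING levels at format `N` inside `m`: the levels `k` whose weight vectors of type `((k^N))³` in degree `kN` do not all
vanish on `GL_m³·⟨m⟩`. [this node] -/
def passLevels (N : ℕ) : Set ℕ :=
  {k | ¬ hwvSpace (rectType m N k) (k * N) ≤ orbitVanishing (unitTensor ℂ m)}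

/-- The levels of a POINT `t`: those `k` having a weight vector of type `((k^N))³` in degree `kN` that is non-zero at `t`.
[cite: BurgisserIkenmeyer2017, (5.2), Thm 5.3 (`E'(w)`)] -/
def pointLevels (N : ℕ) (t : Tensor ℂ m) : Set ℕ :=
  {k | ∃ f ∈ hwvSpace (rectType m N k) (k * N), evalT t f ≠ 0}

variable (m) in
/-- The EMPTY levels at format `N` inside `m`: no weight vector of type `((k^N))³` in degree `kN` (`k_N(k) = 0`, or the
label does not fit into `m` parts). [bookkeeping] -/
def emptyLevels (N : ℕ) : Set ℕ :=
  {k | hwvSpace (rectType m N k) (k * N) = ⊥}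

/-- Passing levels form a semigroup (primality of `I(GL_m³·⟨m⟩)`). [cite: BurgisserIkenmeyer2011, Lemma 3.2] -/
theorem add_mem_passLevels {N a b : ℕ} (ha : a ∈ passLevels m N) (hb : b ∈ passLevels m N) :
    a + b ∈ passLevels m N := by
  have h := not_hwvSpace_add_le_orbitVanishing_unitTensor ha hb
  rwa [rectType_add, ← add_mul] at h

/-- Level `0` passes (the constant `1` does not vanish on the orbit). [bookkeeping] -/
theorem zero_mem_passLevels (N : ℕ) : 0 ∈ passLevels m N := by
  have h0 : rectType m N 0 = 0 := by
    funext s i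
    simp [rectType]
  show ¬ hwvSpace (rectType m N 0) (0 * N) ≤ orbitVanishing (unitTensor ℂ m)
  rw [h0, zero_mul]
  exact fun hle => one_not_mem_orbitVanishing_unitTensor (hle one_mem_hwvSpace_zero)

/-- R1 in level language: a non-empty level of degree `kN ≤ m` passes. [this node] -/
theorem mem_passLevels_of_degree_le {N k : ℕ} (hk : k * N ≤ m) (hne : k ∉ emptyLevels m N) :
    k ∈ passLevels m N :=
  not_le_orbitVanishing_unitTensor_of_degree_le hk hne

/-- Level `0` belongs to every point (the constant `1`). [bookkeeping] -/
theorem zero_mem_pointLevels (N : ℕ) (t : Tensor ℂ m) : 0 ∈ pointLevels N t := by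
  refine ⟨1, ?_, by simp⟩
  have h0 : rectType m N 0 = 0 := by
    funext s i
    simp [rectType]
  rw [h0, zero_mul]
  exact one_mem_hwvSpace_zero

/-- The levels of a point form a monoid: `(f·g)(t) = f(t)·g(t)`. [cite: BurgisserIkenmeyer2017, Thm 5.3] -/
theorem add_mem_pointLevels {N a b : ℕ} {t : Tensor ℂ m} (ha : a ∈ pointLevels N t) (hb : b ∈ pointLevels N t) :
    a + b ∈ pointLevels N t := by
  obtain ⟨f, hf, hfa⟩ := ha
  obtain ⟨g, hg, hgb⟩ := hb
  refine ⟨f * g, ?_, ?_⟩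
  · have h := mul_mem_hwvSpace hf hg
    rwa [rectType_add, ← add_mul] at h
  · rw [map_mul]
    exact mul_ne_zero hfa hgb

/-- The levels of the padded unit tensor `⟨N⟩ = [P|P|P]` all pass. [this node] -/
theorem pointLevels_padUnitLast_subset_passLevels (N : ℕ) :
    pointLevels N (padUnitLast m N) ⊆ passLevels m N := by
  rintro k ⟨f, hf, hval⟩ hle
  exact hval (evalT_fromCols_eq_zero_of_mem_orbitVanishing (hle hf) _ _ _)

/-! ### 3 · The cell theorem (H6) from the four level hypotheses -/

/-- An even level `≥ n` passes at every cell, by (U). [this node] -/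
theorem mem_passLevels_of_unitLevels {n : ℕ}
    (hU : ∀ e : ℕ, Even e → n ≤ e → e ∈ pointLevels (n * n) (padUnitLast m (n * n))) {e : ℕ} (he : Even e)
    (hne : n ≤ e) : e ∈ passLevels m (n * n) :=
  pointLevels_padUnitLast_subset_passLevels (n * n) (hU e he hne)

/-- **H6 (cell theorem): the semigroup reduction of the invariant tower at the cell `(n, m)`.**  Hypotheses: (K0) levels
`0 < k < n` empty; (U) even levels `≥ n` are levels of the point `⟨n²⟩`; (Ko) some odd level `o ∈ {n, n+1}` is non-empty; (P) every
non-empty odd level `k ∈ [n, 2n)` of degree `k n² > m` passes.  Conclusion: every level of degree `> m` passes or is empty.  Even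
levels pass by (U); an odd level `k ≥ 2n+1` is `o + (k − o)` with `o` passing (R1 if `o n² ≤ m`, else (P)) and `k − o ≥ n` even;
odd `k < 2n` is (P). [cite: BurgisserIkenmeyer2017, Thm 5.9, Problem 5.23; BurgisserIkenmeyer2011, Lemma 3.2] -/
theorem tower_of_levels (n : ℕ)
    (hK0 : ∀ k : ℕ, 0 < k → k < n → k ∈ emptyLevels m (n * n))
    (hU : ∀ e : ℕ, Even e → n ≤ e → e ∈ pointLevels (n * n) (padUnitLast m (n * n)))
    (hKo : ∃ o : ℕ, Odd o ∧ n ≤ o ∧ o ≤ n + 1 ∧ o ∉ emptyLevels m (n * n))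
    (hP : ∀ k : ℕ, Odd k → n ≤ k → k < 2 * n → m < k * (n * n) → k ∉ emptyLevels m (n * n) →
      k ∈ passLevels m (n * n)) :
    ∀ k : ℕ, m < k * (n * n) → k ∈ passLevels m (n * n) ∪ emptyLevels m (n * n) := by
  intro k hk
  rw [Set.mem_union, or_iff_not_imp_right]
  intro hne
  have hk0 : 0 < k := by
    rcases Nat.eq_zero_or_pos k with h | h
    · subst h; simp at hk
    · exact h
  have hkn : n ≤ k := by
    by_contra h
    exact hne (hK0 k hk0 (lt_of_not_ge h))
  rcases Nat.even_or_odd k with he | ho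
  · exact mem_passLevels_of_unitLevels hU he hkn
  · by_cases hk2 : k < 2 * n
    · exact hP k ho hkn hk2 hk hne
    · have hn0 : 0 < n := by
        rcases Nat.eq_zero_or_pos n with h | h
        · subst h; simp at hk
        · exact h
      have hk2' : 2 * n + 1 ≤ k := by
        have hne2 : k ≠ 2 * n := fun h => (Nat.not_even_iff_odd.2 ho) (h ▸ even_two_mul n)
        omega
      obtain ⟨o, ho', hno, hon, hWo⟩ := hKo
      have ho2n : o < 2 * n := by
        obtain ⟨j, hj⟩ := ho'
        omega
      have hoU : o ∈ passLevels m (n * n) := by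
        by_cases hom : o * (n * n) ≤ m
        · exact mem_passLevels_of_degree_le hom hWo
        · exact hP o ho' hno ho2n (lt_of_not_ge hom) hWo
      have hok : o ≤ k := by omega
      have hko : Even (k - o) := Nat.Odd.sub_odd ho ho'
      have hkon : n ≤ k - o := by omega
      have h3 := add_mem_passLevels hoU (mem_passLevels_of_unitLevels hU hko hkon)
      rwa [Nat.add_sub_cancel' hok] at h3

/-- **H6a: above the `F_n` wall (`2n·n² ≤ m`) hypothesis (P) is vacuous** — the tower at the cell follows from (K0), (U), (Ko)
alone, with no information about `σ_m`. [this node] -/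
theorem tower_of_unitLevels (n : ℕ) (hm : 2 * n * (n * n) ≤ m)
    (hK0 : ∀ k : ℕ, 0 < k → k < n → k ∈ emptyLevels m (n * n))
    (hU : ∀ e : ℕ, Even e → n ≤ e → e ∈ pointLevels (n * n) (padUnitLast m (n * n)))
    (hKo : ∃ o : ℕ, Odd o ∧ n ≤ o ∧ o ≤ n + 1 ∧ o ∉ emptyLevels m (n * n)) :
    ∀ k : ℕ, m < k * (n * n) → k ∈ passLevels m (n * n) ∪ emptyLevels m (n * n) := by
  refine tower_of_levels n hK0 hU hKo fun k _ _ hk2 hk _ => ?_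
  exfalso
  have : k * (n * n) ≤ 2 * n * (n * n) := Nat.mul_le_mul_right _ hk2.le
  omega

/-- **(U) is a finite check per `n`:** the PRIMITIVE even levels — even `e` with `n ≤ e ≤ 2n` (and `e < 2n` when `n` is even) —
generate all even levels `≥ n` inside the monoid of the point `⟨n²⟩` (`e = (e − e₁) + e₁`, `e₁ ∈ {n, n+1}` even). [this node] -/
theorem unitLevels_of_prim {n : ℕ} (hn : 0 < n)
    (h : ∀ e : ℕ, Even e → n ≤ e → e ≤ 2 * n → (Even n → e < 2 * n) → e ∈ pointLevels (n * n) (padUnitLast m (n * n))) :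
    ∀ e : ℕ, Even e → n ≤ e → e ∈ pointLevels (n * n) (padUnitLast m (n * n)) := by
  intro e
  induction e using Nat.strong_induction_on with
  | _ e ih =>
    intro he hne
    by_cases hsmall : e ≤ 2 * n ∧ (Even n → e < 2 * n)
    · exact h e he hne hsmall.1 hsmall.2
    · rcases Nat.even_or_odd n with hn2 | hn2
      · have hle : 2 * n ≤ e := by
          by_contra hlt
          exact hsmall ⟨by omega, fun _ => by omega⟩
        have h1 : n ∈ pointLevels (n * n) (padUnitLast m (n * n)) :=
          h n hn2 le_rfl (by omega) (fun _ => by omega)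
        have h2 : e - n ∈ pointLevels (n * n) (padUnitLast m (n * n)) :=
          ih (e - n) (by omega) ((Nat.even_sub (by omega)).2 (iff_of_true he hn2)) (by omega)
        have h3 := add_mem_pointLevels h2 h1
        rwa [Nat.sub_add_cancel (by omega)] at h3
      · have hodd : ¬ Even n := Nat.not_even_iff_odd.2 hn2
        have hle : 2 * n + 1 ≤ e := by
          by_contra hlt
          exact hsmall ⟨by omega, fun hn' => absurd hn' hodd⟩
        have hle2 : 2 * n + 2 ≤ e := by
          rcases hle.eq_or_lt with heq | hlt
          · exact absurd (heq ▸ he) (Nat.not_even_iff_odd.2 (odd_two_mul_add_one n))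
          · omega
        have h1 : n + 1 ∈ pointLevels (n * n) (padUnitLast m (n * n)) :=
          h (n + 1) hn2.add_one (by omega) (by omega) (fun hn' => absurd hn' hodd)
        have h2 : e - (n + 1) ∈ pointLevels (n * n) (padUnitLast m (n * n)) :=
          ih (e - (n + 1)) (by omega) ((Nat.even_sub (by omega)).2 (iff_of_true he hn2.add_one)) (by omega)
        have h3 := add_mem_pointLevels h2 h1
        rwa [Nat.sub_add_cancel (by omega)] at h3

end InvariantTower

end Summit.MatrixMultiplication.MatrixMultiplication.Theorems.ObstructionCalculus

/-! ### 4 · Tree bridge: the item `InvariantSaturation` in level language; H6 and H6b at tree level -/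

namespace Summit.MatrixMultiplication.MatrixMultiplication.Theses.ObstructionDescent

open Summit.MatrixMultiplication.MatrixMultiplication.Theorems.ObstructionCalculus
open Literature.Computability.AlgebraicComplexity (unitTensor)

/-- **The item `InvariantSaturation` (stmt-MatrixMultiplication-32282) read in levels:** for every scale `2 < τ < 4`, eventually in
`n` and uniformly in the cells `n² ≤ m`, `n^τ ≤ m`, every level of degree `> m` passes or is empty.  (The item's inlined
weight-vector set is the carrier of `hwvSpace (rectType m n² k) (k n²)` by `rfl`.) [bookkeeping] -/
theorem invariantSaturation_iff_levels : InvariantSaturation ↔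
    ∀ τ : ℝ, 2 < τ → τ < 4 → ∃ n₀ : ℕ, ∀ n m : ℕ, n₀ ≤ n → n * n ≤ m → (n : ℝ) ^ τ ≤ (m : ℝ) →
      ∀ k : ℕ, m < k * (n * n) → k ∈ passLevels m (n * n) ∪ emptyLevels m (n * n) := by
  unfold InvariantSaturation
  refine forall_congr' fun τ => forall_congr' fun _ => forall_congr' fun _ => exists_congr fun n₀ =>
    forall_congr' fun n => forall_congr' fun m => forall_congr' fun _ => forall_congr' fun _ =>
    forall_congr' fun _ => forall_congr' fun k => forall_congr' fun _ => ⟨fun H => ?_, fun H W hW hU f hf => ?_⟩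
  · by_cases hp : k ∈ passLevels m (n * n)
    · exact Or.inl hp
    · refine Or.inr ?_
      have hle : hwvSpace (rectType m (n * n) k) (k * (n * n)) ≤ orbitVanishing (unitTensor ℂ m) := by
        by_contra h
        exact hp h
      show hwvSpace (rectType m (n * n) k) (k * (n * n)) = ⊥
      exact (Submodule.eq_bot_iff _).2 fun f hf => H _ rfl (fun g hg => hle hg) f hf
  · subst hW
    rcases H with hpass | hempty
    · have hle : hwvSpace (rectType m (n * n) k) (k * (n * n)) ≤ orbitVanishing (unitTensor ℂ m) :=
        fun g hg => hU g hg
      exact absurd hle hpass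
    · have hbot : hwvSpace (rectType m (n * n) k) (k * (n * n)) = ⊥ := hempty
      exact (Submodule.eq_bot_iff _).1 hbot f hf

/-- For `τ > 3`, eventually `2n·n² ≤ n^τ`. [bookkeeping] -/
theorem eventually_primitive_bound_le_rpow {τ : ℝ} (hτ : 3 < τ) :
    ∃ n₀ : ℕ, ∀ n : ℕ, n₀ ≤ n → ((2 * n * (n * n) : ℕ) : ℝ) ≤ (n : ℝ) ^ τ := by
  have ht : Tendsto (fun n : ℕ => (n : ℝ) ^ (τ - 3)) atTop atTop :=
    (tendsto_rpow_atTop (by linarith)).comp tendsto_natCast_atTop_atTop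
  obtain ⟨N', hN'⟩ := eventually_atTop.1 (ht.eventually_ge_atTop 4)
  refine ⟨max N' 1, fun n hn => ?_⟩
  have hnN' : N' ≤ n := le_trans (le_max_left _ _) hn
  have hn1 : (1 : ℝ) ≤ n := by exact_mod_cast le_trans (le_max_right _ _) hn
  have hpos : (0 : ℝ) < n := by linarith
  have h4 : (4 : ℝ) ≤ (n : ℝ) ^ (τ - 3) := hN' n hnN'
  have hsplit : (n : ℝ) ^ τ = (n : ℝ) ^ (3 : ℕ) * (n : ℝ) ^ (τ - 3) := by
    rw [← Real.rpow_natCast, ← Real.rpow_add hpos]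
    norm_num
  rw [hsplit]
  have h3 : (0 : ℝ) ≤ (n : ℝ) ^ (3 : ℕ) := by positivity
  calc ((2 * n * (n * n) : ℕ) : ℝ) = 2 * n * (n * n) := by push_cast; ring
    _ ≤ (n : ℝ) ^ (3 : ℕ) * 4 := by nlinarith
    _ ≤ (n : ℝ) ^ (3 : ℕ) * (n : ℝ) ^ (τ - 3) := by gcongr

/-- **H6 at tree level (CONDITIONAL reduction; credits nothing by itself).**  If, eventually in `n` and for all `m ≥ n²`, the four
level hypotheses (K0), (U), (Ko), (P) hold at the cell `(n, m)`, then the item `InvariantSaturation` holds. [this node] -/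
theorem invariantSaturation_of_levelHypotheses
    (h : ∃ n₁ : ℕ, ∀ n m : ℕ, n₁ ≤ n → n * n ≤ m →
      (∀ k : ℕ, 0 < k → k < n → k ∈ emptyLevels m (n * n)) ∧
      (∀ e : ℕ, Even e → n ≤ e → e ∈ pointLevels (n * n) (padUnitLast m (n * n))) ∧
      (∃ o : ℕ, Odd o ∧ n ≤ o ∧ o ≤ n + 1 ∧ o ∉ emptyLevels m (n * n)) ∧
      (∀ k : ℕ, Odd k → n ≤ k → k < 2 * n → m < k * (n * n) → k ∉ emptyLevels m (n * n) → k ∈ passLevels m (n * n))) :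
    InvariantSaturation := by
  obtain ⟨n₁, h⟩ := h
  refine invariantSaturation_iff_levels.2 fun τ _ _ => ⟨n₁, fun n m hn hnm _ => ?_⟩
  obtain ⟨hK0, hU, hKo, hP⟩ := h n m hn hnm
  exact tower_of_levels n hK0 hU hKo hP

/-- **H6b: for `3 < τ < 4` the invariant tower is unit-tensor combinatorics plus Kronecker positivity.**  If (K0), (U), (Ko) hold
eventually in `n` for all `m ≥ n²`, then the level reading of the tower holds at every scale `3 < τ < 4` — with no hypothesis
about `σ_m`. PROVED. [this node] -/
theorem invariantSaturation_three_of_unitLevels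
    (h : ∃ n₁ : ℕ, ∀ n m : ℕ, n₁ ≤ n → n * n ≤ m →
      (∀ k : ℕ, 0 < k → k < n → k ∈ emptyLevels m (n * n)) ∧
      (∀ e : ℕ, Even e → n ≤ e → e ∈ pointLevels (n * n) (padUnitLast m (n * n))) ∧
      (∃ o : ℕ, Odd o ∧ n ≤ o ∧ o ≤ n + 1 ∧ o ∉ emptyLevels m (n * n))) :
    ∀ τ : ℝ, 3 < τ → τ < 4 → ∃ n₀ : ℕ, ∀ n m : ℕ, n₀ ≤ n → n * n ≤ m → (n : ℝ) ^ τ ≤ (m : ℝ) →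
      ∀ k : ℕ, m < k * (n * n) → k ∈ passLevels m (n * n) ∪ emptyLevels m (n * n) := by
  obtain ⟨n₁, h⟩ := h
  intro τ hτ3 _
  obtain ⟨n₂, hn₂⟩ := eventually_primitive_bound_le_rpow hτ3
  refine ⟨max n₁ n₂, fun n m hn hnm hτm => ?_⟩
  obtain ⟨hK0, hU, hKo⟩ := h n m (le_trans (le_max_left _ _) hn) hnm
  have hbound : 2 * n * (n * n) ≤ m := by
    have h1 := hn₂ n (le_trans (le_max_right _ _) hn)
    exact_mod_cast h1.trans hτm
  exact tower_of_unitLevels n hbound hK0 hU hKo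

end Summit.MatrixMultiplication.MatrixMultiplication.Theses.ObstructionDescent

end
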